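import Summits.HodgeConjecture.HodgeCM.Model.WeilCentralCoinvariants_1

/-! PORT of `HodgeCM/Model/WeilCentralCoinvariants.lean` (HodgeCMPerL run 82) — part 2: continuation of `Summits.HodgeConjecture.HodgeCM.Model.WeilCentralCoinvariants_1` (split at a top-level declaration boundary by port_pkg.py; scope re-opened below; declarations unchanged). -/

-- port_pkg: scope re-opened for this part (file-level context, then the namespace/section stack open at the cut)
set_option autoImplicit false
noncomputable section
namespace HodgeCM
namespace TwistedCoinv
section Field
variable {k : Type*} [Field k] {G H S : Type*} [Group G] [Group H] [AddCommGroup S] [Module k S]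
variable {ρW : Representation k H S} (χ χ' : H →* kˣ) (ρV : Representation k G S)

/-- **Distinct central characters ⇒ no non-zero intertwiner** (generic form, `k` a field): if `ρV z = c • ρW w`
on `S` with `c ≠ 0`, then a `G`-intertwiner `T : Coinv ρW χ → Coinv ρW χ'` (for the element `z`) with a non-zero
value forces `χ w = χ' w`. [folklore] -/
theorem char_apply_eq_of_intertwiner (hc : ∀ (g : G) (h : H), Commute (ρV g) (ρW h)) {z : G} {w : H} {c : k} (hc0 : c ≠ 0)
    (hzw : ∀ v : S, ρV z v = c • ρW w v) (T : Coinv ρW χ →ₗ[k] Coinv ρW χ')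
    (hT : ∀ x : Coinv ρW χ, T (rep χ ρV hc z x) = rep χ' ρV hc z (T x)) {x : Coinv ρW χ} (hx : T x ≠ 0) :
    χ w = χ' w := by
  have h1 := hT x
  rw [rep_eq_smul_of_forall χ ρV hc hzw, rep_eq_smul_of_forall χ' ρV hc hzw, map_smul] at h1
  have h2 : (c * ((χ w : kˣ) : k) - c * ((χ' w : kˣ) : k)) • T x = 0 := by
    rw [sub_smul, h1, sub_self]
  rcases smul_eq_zero.1 h2 with h3 | h3
  · exact Units.ext (mul_left_cancel₀ hc0 (sub_eq_zero.1 h3))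
  · exact absurd h3 hx

/-- Contrapositive packaging: if `χ w ≠ χ' w` then every `G`-intertwiner (for `z`) `Coinv ρW χ → Coinv ρW χ'` is
zero. [folklore] -/
theorem intertwiner_eq_zero_of_char_apply_ne (hc : ∀ (g : G) (h : H), Commute (ρV g) (ρW h)) {z : G} {w : H} {c : k} (hc0 : c ≠ 0)
    (hzw : ∀ v : S, ρV z v = c • ρW w v) (hne : χ w ≠ χ' w) (T : Coinv ρW χ →ₗ[k] Coinv ρW χ')
    (hT : ∀ x : Coinv ρW χ, T (rep χ ρV hc z x) = rep χ' ρV hc z (T x)) : T = 0 := by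
  refine LinearMap.ext fun x => ?_
  by_contra hx
  exact hne (char_apply_eq_of_intertwiner χ χ' ρV hc hc0 hzw T hT hx)

end Field

end TwistedCoinv
end HodgeCM

/-! ## §2. The finite Weil representation of the finite-adelic unitary dual pair and its central coinvariants -/

namespace HodgeCM
namespace WeilCoinv

open Literature.NumberTheory.GelbartRogawski1991 Literature.NumberTheory.GelbartRogawski1991.UnitaryDualPair
open Literature.NumberTheory.Automorphic Literature.NumberTheory.Weil1964
open scoped Kronecker
open NumberField

variable (F E : Type) [Field F] [NumberField F] [Field E] [NumberField E] [Algebra F E]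
variable (c : E ≃ₐ[F] E) (N M : ℕ) {n : ℕ} (e : Fin N × Fin M ≃ Fin n)
variable (JV : Matrix (Fin N) (Fin N) E) (JW : Matrix (Fin M) (Fin M) E)
variable {TV : Matrix (Fin N) (Fin N) F} {TW : Matrix (Fin M) (Fin M) F}

/-- The finite-adelic dual pair inside the adelic one: `(k, u) ↦ ((1, k), (1, u))`
(`UnitaryGroup.finAdelicToAdelic` on both members). [folklore] -/
def finPairToAdelic :
    UnitaryGroup.finAdelic F E c N JV × UnitaryGroup.finAdelic F E c M JW →*
      UnitaryGroup.adelic F E c N JV × UnitaryGroup.adelic F E c M JW :=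
  MonoidHom.prodMap (UnitaryGroup.finAdelicToAdelic F E c N JV) (UnitaryGroup.finAdelicToAdelic F E c M JW)

/-- (Ported verbatim from the HodgeCMPerL package; no docstring in the source.) -/
@[simp] theorem finPairToAdelic_apply (p : UnitaryGroup.finAdelic F E c N JV × UnitaryGroup.finAdelic F E c M JW) :
    finPairToAdelic F E c N M JV JW p =
      (UnitaryGroup.finAdelicToAdelic F E c N JV p.1, UnitaryGroup.finAdelicToAdelic F E c M JW p.2) := rfl

variable [Algebra.IsQuadraticExtension F E] {δ : E} (hcδ : c δ = -δ) (hδ : δ ≠ 0) {d : F}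
  (hd : δ * δ = algebraMap F E d) (hV : TV.IsSymm) (hW : TW.IsSymm) (hVd : IsUnit TV.det) (hWd : IsUnit TW.det)
  (hJV : JV = TV.map (algebraMap F E)) (hJW : JW = TW.map (algebraMap F E))
  {s : UnitaryGroup.adelicPair F E c N M JV JW →* adelicMpCont F (Fin n) (adelicGram F e TV TW)}

/-- **The finite Weil representation `ω_f ∘ s_pair` of the finite-adelic dual pair
`U(J_V)(𝔸_{F,f}) × U(J_W)(𝔸_{F,f})` on `𝒮((𝔸_F^∞)^{N M})`** through a COMPATIBLE pair splitting `s`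
(`Weil1964.finRepMp` of the pair splitting read back along `e`, `pairSmall₁ s`, at the finite-adelic points; the
archimedean-vector hypothesis is the tree's `proj_pairSmall₁_finAdelic_apply_archVec`).  This is the representation
whose local factors are Liu's `ω_v|_{U(V) × U(W)}` at the nonarchimedean places.
[cite: Weil1964, Chap. III n° 37–38 p. 188–190; GelbartRogawski1991, §3.1 Prop. 3.1.1 p. 455; Liu21, App. D Step 3] -/
def finPairRep (hs : (splittingDatum F E c N M e JV JW hcδ hδ hd hV hW hVd hWd hJV hJW).IsCompatible s) :
    Representation ℂ (UnitaryGroup.finAdelic F E c N JV × UnitaryGroup.finAdelic F E c M JW)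
      (FinSB F (Fin N × Fin M)) :=
  finRepMp (isUnit_kronecker_map F N hVd hWd)
    ((pairSmall₁ F E c N M e JV JW s).comp (finPairToAdelic F E c N M JV JW))
    (fun p a w => proj_pairSmall₁_finAdelic_apply_archVec F E c N M e JV JW hcδ hδ hd hV hW hVd hWd hJV hJW hs
      p.1 p.2 a w)

/-- its restriction to the `U(J_V)`-member, `k ↦ ω_f(s_pair((1,k), 1))`. [folklore] -/
def finPairRepV (hs : (splittingDatum F E c N M e JV JW hcδ hδ hd hV hW hVd hWd hJV hJW).IsCompatible s) :
    Representation ℂ (UnitaryGroup.finAdelic F E c N JV) (FinSB F (Fin N × Fin M)) :=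
  (finPairRep F E c N M e JV JW hcδ hδ hd hV hW hVd hWd hJV hJW hs).comp (MonoidHom.inl _ _)

/-- its restriction to the `U(J_W)`-member, `u ↦ ω_f(s_pair(1, (1,u)))`. [folklore] -/
def finPairRepW (hs : (splittingDatum F E c N M e JV JW hcδ hδ hd hV hW hVd hWd hJV hJW).IsCompatible s) :
    Representation ℂ (UnitaryGroup.finAdelic F E c M JW) (FinSB F (Fin N × Fin M)) :=
  (finPairRep F E c N M e JV JW hcδ hδ hd hV hW hVd hWd hJV hJW hs).comp (MonoidHom.inr _ _)

/-- (Ported verbatim from the HodgeCMPerL package; no docstring in the source.) -/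
theorem finPairRepV_apply (hs : (splittingDatum F E c N M e JV JW hcδ hδ hd hV hW hVd hWd hJV hJW).IsCompatible s)
    (k : UnitaryGroup.finAdelic F E c N JV) :
    finPairRepV F E c N M e JV JW hcδ hδ hd hV hW hVd hWd hJV hJW hs k =
      finPairRep F E c N M e JV JW hcδ hδ hd hV hW hVd hWd hJV hJW hs (k, 1) := rfl

/-- (Ported verbatim from the HodgeCMPerL package; no docstring in the source.) -/
theorem finPairRepW_apply (hs : (splittingDatum F E c N M e JV JW hcδ hδ hd hV hW hVd hWd hJV hJW).IsCompatible s)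
    (u : UnitaryGroup.finAdelic F E c M JW) :
    finPairRepW F E c N M e JV JW hcδ hδ hd hV hW hVd hWd hJV hJW hs u =
      finPairRep F E c N M e JV JW hcδ hδ hd hV hW hVd hWd hJV hJW hs (1, u) := rfl

/-- `ω_f(s_pair(k, u)) = ω_f(s_pair(k, 1)) ω_f(s_pair(1, u))`. [folklore] -/
theorem finPairRep_eq_mul (hs : (splittingDatum F E c N M e JV JW hcδ hδ hd hV hW hVd hWd hJV hJW).IsCompatible s)
    (k : UnitaryGroup.finAdelic F E c N JV) (u : UnitaryGroup.finAdelic F E c M JW) :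
    finPairRep F E c N M e JV JW hcδ hδ hd hV hW hVd hWd hJV hJW hs (k, u) =
      finPairRepV F E c N M e JV JW hcδ hδ hd hV hW hVd hWd hJV hJW hs k *
        finPairRepW F E c N M e JV JW hcδ hδ hd hV hW hVd hWd hJV hJW hs u := by
  rw [finPairRepV_apply, finPairRepW_apply, ← map_mul, Prod.mk_mul_mk, mul_one, one_mul]

/-- **the two members commute** in the finite Weil representation (they commute in the product group).
[folklore] -/
theorem commute_finPairRepV_finPairRepW
    (hs : (splittingDatum F E c N M e JV JW hcδ hδ hd hV hW hVd hWd hJV hJW).IsCompatible s)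
    (k : UnitaryGroup.finAdelic F E c N JV) (u : UnitaryGroup.finAdelic F E c M JW) :
    Commute (finPairRepV F E c N M e JV JW hcδ hδ hd hV hW hVd hWd hJV hJW hs k)
      (finPairRepW F E c N M e JV JW hcδ hδ hd hV hW hVd hWd hJV hJW hs u) := by
  change finPairRepV F E c N M e JV JW hcδ hδ hd hV hW hVd hWd hJV hJW hs k *
      finPairRepW F E c N M e JV JW hcδ hδ hd hV hW hVd hWd hJV hJW hs u =
    finPairRepW F E c N M e JV JW hcδ hδ hd hV hW hVd hWd hJV hJW hs u *
      finPairRepV F E c N M e JV JW hcδ hδ hd hV hW hVd hWd hJV hJW hs k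
  rw [finPairRepV_apply, finPairRepW_apply, ← map_mul, ← map_mul, Prod.mk_mul_mk, Prod.mk_mul_mk, mul_one, one_mul,
    mul_one, one_mul]

/-! ### §2a  The `arch ⊗ fin` factorisation of `ω ∘ s_pair` at the finite-adelic points

At a finite-adelic pair element `(ι k, ι u)` the honest pair representation acts on pure tensors `Φ_∞ ⊗ Φ_f` through the
finite factor alone: `ω(s_pair(ι k, ι u)) (Φ_∞ ⊗ Φ_f) = Φ_∞ ⊗ ω_f(k, u) Φ_f`, `ω_f = finPairRep`.  Stated in both Schwartz
currencies of the tree: the Kronecker currency `𝒮(𝔸^{N × M})` of `pairSmall₁ s` (Weil1964 `omega_map_tmul_finRepMp`) and the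
`Fin n` currency `𝒮(𝔸^n)` of `pairRep s = ω_ψ ∘ s_pair` (read through the re-indexing `R_e = piSBReindex F e`, tree
`omega_pairSmall₁_apply`; `R_e` is itself a pure-tensor operator, tree `piSBReindex_tmul`).
[cite: Weil1964, Chap. III n° 37–38 p. 188–190; GelbartRogawski1991, §3.1 p. 454] -/

section ArchFinFactorisation

open scoped SchwartzMap TensorProduct Classical
open NumberField.mixedEmbedding IsDedekindDomain

/-- **Kronecker currency**: `ω(pairSmall₁ s (ι k, ι u)) (Φ_∞ ⊗ Φ_f) = Φ_∞ ⊗ finPairRep s (k, u) Φ_f` for EVERY archimedean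
`Φ_∞` and EVERY finite `Φ_f`. [cite: Weil1964, Chap. III n° 37–38 p. 188–190] -/
theorem omega_pairSmall₁_finPairToAdelic_tmul
    (hs : (splittingDatum F E c N M e JV JW hcδ hδ hd hV hW hVd hWd hJV hJW).IsCompatible s)
    (p : UnitaryGroup.finAdelic F E c N JV × UnitaryGroup.finAdelic F E c M JW)
    (Φ : 𝓢(((Fin N × Fin M) → mixedSpace F), ℂ)) (f : FinSB F (Fin N × Fin M)) :
    adelicMpCont.omega F (Fin N × Fin M) _ (pairSmall₁ F E c N M e JV JW s (finPairToAdelic F E c N M JV JW p))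
        (piSchwartzBruhatEquiv F (Fin N × Fin M) (Φ ⊗ₜ[ℂ] f)) =
      piSchwartzBruhatEquiv F (Fin N × Fin M)
        (Φ ⊗ₜ[ℂ] finPairRep F E c N M e JV JW hcδ hδ hd hV hW hVd hWd hJV hJW hs p f) :=
  omega_map_tmul_finRepMp (isUnit_kronecker_map F N hVd hWd)
    ((pairSmall₁ F E c N M e JV JW s).comp (finPairToAdelic F E c N M JV JW))
    (fun p a w => proj_pairSmall₁_finAdelic_apply_archVec F E c N M e JV JW hcδ hδ hd hV hW hVd hWd hJV hJW hs
      p.1 p.2 a w) p Φ f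

/-- **`Fin n` currency**: `(ω_ψ ∘ s_pair)(ι k, ι u) (R_e (Φ_∞ ⊗ Φ_f)) = R_e (Φ_∞ ⊗ finPairRep s (k, u) Φ_f)`, `R_e = piSBReindex F e`
(so, with the tree's `piSBReindex_tmul`, `ω_ψ(s_pair(ι k, ι u))` is `1 ⊗ (R_e^f ∘ ω_f(k,u) ∘ (R_e^f)⁻¹)` on `𝒮(𝔸^n)`).
[cite: Weil1964, Chap. III n° 37–38 p. 188–190; GelbartRogawski1991, §3.1 p. 454] -/
theorem pairRep_finPairToAdelic_piSBReindex_tmul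
    (hs : (splittingDatum F E c N M e JV JW hcδ hδ hd hV hW hVd hWd hJV hJW).IsCompatible s)
    (p : UnitaryGroup.finAdelic F E c N JV × UnitaryGroup.finAdelic F E c M JW)
    (Φ : 𝓢(((Fin N × Fin M) → mixedSpace F), ℂ)) (f : FinSB F (Fin N × Fin M)) :
    pairRep F E c N M e JV JW s (finPairToAdelic F E c N M JV JW p)
        (piSBReindex F e (piSchwartzBruhatEquiv F (Fin N × Fin M) (Φ ⊗ₜ[ℂ] f))) =
      piSBReindex F e (piSchwartzBruhatEquiv F (Fin N × Fin M)
        (Φ ⊗ₜ[ℂ] finPairRep F E c N M e JV JW hcδ hδ hd hV hW hVd hWd hJV hJW hs p f)) := by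
  rw [← omega_pairSmall₁_finPairToAdelic_tmul F E c N M e JV JW hcδ hδ hd hV hW hVd hWd hJV hJW hs p Φ f,
    omega_pairSmall₁_apply, LinearEquiv.apply_symm_apply]

end ArchFinFactorisation

variable (χ : UnitaryGroup.finAdelic F E c M JW →* ℂˣ)

/-- **`Ω(s, χ)`: the `χ`-coinvariants of `ω_f ∘ s_pair` under `U(J_W)(𝔸_{F,f})`, as a representation of
`U(J_V)(𝔸_{F,f})`** — the cell-side reading of Liu's `ω(μ, ε, χ) = ⊗'_v ω(μ_v, ε_v, χ_v)` for the oscillator triple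
whose splitting `ι_μ` is `s` ([Liu21, App. D Step 2], [GelbartRogawski1991, Remark p. 457]).  At the cell's data
`(L⁺, L, complexConj, 3, V.Hm)` the group `↥(UnitaryGroup.finAdelic …)` is `↥V.adelicFin`.
[cite: Liu21, Def. 4.10 display (4.2) p. 20, App. D proof of Lemma D.1 Step 3] -/
def weilCoinv (hs : (splittingDatum F E c N M e JV JW hcδ hδ hd hV hW hVd hWd hJV hJW).IsCompatible s) :
    Representation ℂ (UnitaryGroup.finAdelic F E c N JV)
      (TwistedCoinv.Coinv (finPairRepW F E c N M e JV JW hcδ hδ hd hV hW hVd hWd hJV hJW hs) χ) :=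
  TwistedCoinv.rep χ (finPairRepV F E c N M e JV JW hcδ hδ hd hV hW hVd hWd hJV hJW hs)
    (commute_finPairRepV_finPairRepW F E c N M e JV JW hcδ hδ hd hV hW hVd hWd hJV hJW hs)

/-- `Ω(s, χ)` on generators: `weilCoinv k (mk f) = mk (ω_f(s_pair(k, 1)) f)`. [folklore] -/
@[simp] theorem weilCoinv_mk (hs : (splittingDatum F E c N M e JV JW hcδ hδ hd hV hW hVd hWd hJV hJW).IsCompatible s)
    (k : UnitaryGroup.finAdelic F E c N JV) (f : FinSB F (Fin N × Fin M)) :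
    weilCoinv F E c N M e JV JW hcδ hδ hd hV hW hVd hWd hJV hJW χ hs k
        (TwistedCoinv.mk (finPairRepW F E c N M e JV JW hcδ hδ hd hV hW hVd hWd hJV hJW hs) χ f) =
      TwistedCoinv.mk (finPairRepW F E c N M e JV JW hcδ hδ hd hV hW hVd hWd hJV hJW hs) χ
        (finPairRep F E c N M e JV JW hcδ hδ hd hV hW hVd hWd hJV hJW hs (k, 1) f) := rfl

/-- `U(J_W)(𝔸_{F,f})` acts on `Ω(s, χ)` through `χ`: `mk (ω_f(s_pair(1, u)) f) = χ u • mk f`. [folklore] -/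
theorem mk_finPairRep_one (hs : (splittingDatum F E c N M e JV JW hcδ hδ hd hV hW hVd hWd hJV hJW).IsCompatible s)
    (u : UnitaryGroup.finAdelic F E c M JW) (f : FinSB F (Fin N × Fin M)) :
    TwistedCoinv.mk (finPairRepW F E c N M e JV JW hcδ hδ hd hV hW hVd hWd hJV hJW hs) χ
        (finPairRep F E c N M e JV JW hcδ hδ hd hV hW hVd hWd hJV hJW hs (1, u) f) =
      ((χ u : ℂˣ) : ℂ) •
        TwistedCoinv.mk (finPairRepW F E c N M e JV JW hcδ hδ hd hV hW hVd hWd hJV hJW hs) χ f :=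
  TwistedCoinv.mk_ρW _ χ u f

/-- the pair on `Ω(s, χ)`: `mk (ω_f(s_pair(k, u)) f) = χ u • weilCoinv k (mk f)`. [folklore] -/
theorem mk_finPairRep (hs : (splittingDatum F E c N M e JV JW hcδ hδ hd hV hW hVd hWd hJV hJW).IsCompatible s)
    (k : UnitaryGroup.finAdelic F E c N JV) (u : UnitaryGroup.finAdelic F E c M JW) (f : FinSB F (Fin N × Fin M)) :
    TwistedCoinv.mk (finPairRepW F E c N M e JV JW hcδ hδ hd hV hW hVd hWd hJV hJW hs) χ
        (finPairRep F E c N M e JV JW hcδ hδ hd hV hW hVd hWd hJV hJW hs (k, u) f) =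
      ((χ u : ℂˣ) : ℂ) •
        weilCoinv F E c N M e JV JW hcδ hδ hd hV hW hVd hWd hJV hJW χ hs k
          (TwistedCoinv.mk (finPairRepW F E c N M e JV JW hcδ hδ hd hV hW hVd hWd hJV hJW hs) χ f) := by
  rw [finPairRep_eq_mul, Module.End.mul_apply]
  exact TwistedCoinv.mk_ρV_ρW χ _ (commute_finPairRepV_finPairRepW F E c N M e JV JW hcδ hδ hd hV hW hVd hWd hJV hJW hs)
    k u f

section Lift

variable {H : Type*} [AddCommGroup H] [Module ℂ H]

/-- **`θ̄`-shape universal property**: a linear map `f : 𝒮((𝔸_F^∞)^{NM}) → H` with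
`f (ω_f(s_pair(1, u)) φ) = χ u • f φ` factors through `Ω(s, χ)`. [folklore] -/
def weilCoinvLift (hs : (splittingDatum F E c N M e JV JW hcδ hδ hd hV hW hVd hWd hJV hJW).IsCompatible s)
    (f : FinSB F (Fin N × Fin M) →ₗ[ℂ] H)
    (hf : ∀ (u : UnitaryGroup.finAdelic F E c M JW) (φ : FinSB F (Fin N × Fin M)),
      f (finPairRep F E c N M e JV JW hcδ hδ hd hV hW hVd hWd hJV hJW hs (1, u) φ) = ((χ u : ℂˣ) : ℂ) • f φ) :
    TwistedCoinv.Coinv (finPairRepW F E c N M e JV JW hcδ hδ hd hV hW hVd hWd hJV hJW hs) χ →ₗ[ℂ] H :=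
  TwistedCoinv.lift _ χ f hf

variable (hs : (splittingDatum F E c N M e JV JW hcδ hδ hd hV hW hVd hWd hJV hJW).IsCompatible s)
  (f : FinSB F (Fin N × Fin M) →ₗ[ℂ] H)
  (hf : ∀ (u : UnitaryGroup.finAdelic F E c M JW) (φ : FinSB F (Fin N × Fin M)),
    f (finPairRep F E c N M e JV JW hcδ hδ hd hV hW hVd hWd hJV hJW hs (1, u) φ) = ((χ u : ℂˣ) : ℂ) • f φ)

/-- (Ported verbatim from the HodgeCMPerL package; no docstring in the source.) -/
@[simp] theorem weilCoinvLift_mk (φ : FinSB F (Fin N × Fin M)) :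
    weilCoinvLift F E c N M e JV JW hcδ hδ hd hV hW hVd hWd hJV hJW χ hs f hf
        (TwistedCoinv.mk (finPairRepW F E c N M e JV JW hcδ hδ hd hV hW hVd hWd hJV hJW hs) χ φ) = f φ := rfl

/-- **`range θ̄ = range (f)`** — the image of the factored map is the image of `f` (for `f = P_χ ∘ θ`: the theta
`χ`-module). [folklore] -/
theorem range_weilCoinvLift :
    LinearMap.range (weilCoinvLift F E c N M e JV JW hcδ hδ hd hV hW hVd hWd hJV hJW χ hs f hf) = LinearMap.range f :=
  TwistedCoinv.range_lift _ χ f hf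

/-- the factored map vanishes iff `f` does. [folklore] -/
theorem weilCoinvLift_eq_zero_iff :
    weilCoinvLift F E c N M e JV JW hcδ hδ hd hV hW hVd hWd hJV hJW χ hs f hf = 0 ↔ f = 0 :=
  TwistedCoinv.lift_eq_zero_iff _ χ f hf

/-- **`U(J_V)(𝔸_{F,f})`-equivariance of `θ̄`**: if `f` intertwines `ω_f(s_pair(k, 1))` with a representation `σ`
of `U(J_V)(𝔸_{F,f})` on `H` (right translation on theta functions), then `θ̄ ∘ Ω(s,χ)(k) = σ(k) ∘ θ̄`. [folklore] -/
theorem weilCoinvLift_weilCoinv (σ : Representation ℂ (UnitaryGroup.finAdelic F E c N JV) H)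
    (hσ : ∀ (k : UnitaryGroup.finAdelic F E c N JV) (φ : FinSB F (Fin N × Fin M)),
      f (finPairRep F E c N M e JV JW hcδ hδ hd hV hW hVd hWd hJV hJW hs (k, 1) φ) = σ k (f φ))
    (k : UnitaryGroup.finAdelic F E c N JV)
    (x : TwistedCoinv.Coinv (finPairRepW F E c N M e JV JW hcδ hδ hd hV hW hVd hWd hJV hJW hs) χ) :
    weilCoinvLift F E c N M e JV JW hcδ hδ hd hV hW hVd hWd hJV hJW χ hs f hf
        (weilCoinv F E c N M e JV JW hcδ hδ hd hV hW hVd hWd hJV hJW χ hs k x) =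
      σ k (weilCoinvLift F E c N M e JV JW hcδ hδ hd hV hW hVd hWd hJV hJW χ hs f hf x) :=
  TwistedCoinv.lift_rep χ _ _ f hf σ hσ k x

/-- the same as an identity of linear maps. [folklore] -/
theorem weilCoinvLift_comp_weilCoinv (σ : Representation ℂ (UnitaryGroup.finAdelic F E c N JV) H)
    (hσ : ∀ (k : UnitaryGroup.finAdelic F E c N JV) (φ : FinSB F (Fin N × Fin M)),
      f (finPairRep F E c N M e JV JW hcδ hδ hd hV hW hVd hWd hJV hJW hs (k, 1) φ) = σ k (f φ))
    (k : UnitaryGroup.finAdelic F E c N JV) :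
    weilCoinvLift F E c N M e JV JW hcδ hδ hd hV hW hVd hWd hJV hJW χ hs f hf ∘ₗ
        weilCoinv F E c N M e JV JW hcδ hδ hd hV hW hVd hWd hJV hJW χ hs k =
      σ k ∘ₗ weilCoinvLift F E c N M e JV JW hcδ hδ hd hV hW hVd hWd hJV hJW χ hs f hf :=
  LinearMap.ext (weilCoinvLift_weilCoinv F E c N M e JV JW hcδ hδ hd hV hW hVd hWd hJV hJW χ hs f hf σ hσ k)

end Lift

/-- **Centre clause, cell-side shape**: if a `U(J_V)`-member `z` and a `U(J_W)`-member `w` have finite Weil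
operators differing by a scalar `c` (the common centre `E¹(𝔸_{F,f})`: `ι(z ⊗ 1) = ι(1 ⊗ w)`, the two values of the
splitting differ by `ker π`, which acts by scalars by Schur's lemma for `ρ_ψ`), then `z` acts on `Ω(s, χ)` by the
scalar `c · χ w`. [cite: MoeglinVignerasWaldspurger1987, Chap. 2 II.2; GelbartRogawski1991, Remark p. 457] -/
theorem weilCoinv_eq_smul_of_forall
    (hs : (splittingDatum F E c N M e JV JW hcδ hδ hd hV hW hVd hWd hJV hJW).IsCompatible s)
    {z : UnitaryGroup.finAdelic F E c N JV} {w : UnitaryGroup.finAdelic F E c M JW} {c₀ : ℂ}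
    (hzw : ∀ φ : FinSB F (Fin N × Fin M),
      finPairRep F E c N M e JV JW hcδ hδ hd hV hW hVd hWd hJV hJW hs (z, 1) φ =
        c₀ • finPairRep F E c N M e JV JW hcδ hδ hd hV hW hVd hWd hJV hJW hs (1, w) φ)
    (x : TwistedCoinv.Coinv (finPairRepW F E c N M e JV JW hcδ hδ hd hV hW hVd hWd hJV hJW hs) χ) :
    weilCoinv F E c N M e JV JW hcδ hδ hd hV hW hVd hWd hJV hJW χ hs z x = (c₀ * ((χ w : ℂˣ) : ℂ)) • x :=
  TwistedCoinv.rep_eq_smul_of_forall χ _ _ hzw x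

/-- **Distinct central characters give no non-zero intertwiner** (cell-side shape of [Liu21] App. D Lemma D.1 (3)
for one splitting and two characters): under the centre relation `ω_f(s_pair(z,1)) = c • ω_f(s_pair(1,w))` with
`c ≠ 0`, a `z`-intertwiner `Ω(s, χ) → Ω(s, χ')` with a non-zero value forces `χ w = χ' w`. [folklore] -/
theorem char_apply_eq_of_intertwiner
    (hs : (splittingDatum F E c N M e JV JW hcδ hδ hd hV hW hVd hWd hJV hJW).IsCompatible s)
    (χ' : UnitaryGroup.finAdelic F E c M JW →* ℂˣ)
    {z : UnitaryGroup.finAdelic F E c N JV} {w : UnitaryGroup.finAdelic F E c M JW} {c₀ : ℂ} (hc0 : c₀ ≠ 0)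
    (hzw : ∀ φ : FinSB F (Fin N × Fin M),
      finPairRep F E c N M e JV JW hcδ hδ hd hV hW hVd hWd hJV hJW hs (z, 1) φ =
        c₀ • finPairRep F E c N M e JV JW hcδ hδ hd hV hW hVd hWd hJV hJW hs (1, w) φ)
    (T : TwistedCoinv.Coinv (finPairRepW F E c N M e JV JW hcδ hδ hd hV hW hVd hWd hJV hJW hs) χ →ₗ[ℂ]
      TwistedCoinv.Coinv (finPairRepW F E c N M e JV JW hcδ hδ hd hV hW hVd hWd hJV hJW hs) χ')
    (hT : ∀ x, T (weilCoinv F E c N M e JV JW hcδ hδ hd hV hW hVd hWd hJV hJW χ hs z x) =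
      weilCoinv F E c N M e JV JW hcδ hδ hd hV hW hVd hWd hJV hJW χ' hs z (T x))
    {x : TwistedCoinv.Coinv (finPairRepW F E c N M e JV JW hcδ hδ hd hV hW hVd hWd hJV hJW hs) χ} (hx : T x ≠ 0) :
    χ w = χ' w :=
  TwistedCoinv.char_apply_eq_of_intertwiner χ χ' _ _ hc0 hzw T hT hx

/-! ### §2b. Central twists of the splitting ([GelbartRogawski1991, Remark p. 457]) -/

section Twist

open Literature.RepresentationTheory

variable (ĉ : UnitaryGroup.adelicPair F E c N M JV JW →* ℂˣ)

omit [Algebra.IsQuadraticExtension F E] in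
/-- the `U(J_V)(𝔸_{F,f})`-part `k ↦ ĉ((1, k) ⊗ 1)` of a character of `G₁(𝔸_F) = U(J_V ⊗ J_W)(𝔸_F)`. [folklore] -/
def twistCharV : UnitaryGroup.finAdelic F E c N JV →* ℂˣ :=
  ĉ.comp ((UnitaryGroup.adelicInl F E c N M JV JW).comp (UnitaryGroup.finAdelicToAdelic F E c N JV))

omit [Algebra.IsQuadraticExtension F E] in
/-- the `U(J_W)(𝔸_{F,f})`-part `u ↦ ĉ(1 ⊗ (1, u))`. [folklore] -/
def twistCharW : UnitaryGroup.finAdelic F E c M JW →* ℂˣ :=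
  ĉ.comp ((UnitaryGroup.adelicInr F E c N M JV JW).comp (UnitaryGroup.finAdelicToAdelic F E c M JW))

omit [Algebra.IsQuadraticExtension F E] in
/-- (Ported verbatim from the HodgeCMPerL package; no docstring in the source.) -/
@[simp] theorem twistCharV_apply (k : UnitaryGroup.finAdelic F E c N JV) :
    twistCharV F E c N M JV JW ĉ k = ĉ (UnitaryGroup.adelicInl F E c N M JV JW (UnitaryGroup.finAdelicToAdelic F E c N JV k)) :=
  rfl

omit [Algebra.IsQuadraticExtension F E] in
/-- (Ported verbatim from the HodgeCMPerL package; no docstring in the source.) -/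
@[simp] theorem twistCharW_apply (u : UnitaryGroup.finAdelic F E c M JW) :
    twistCharW F E c N M JV JW ĉ u = ĉ (UnitaryGroup.adelicInr F E c N M JV JW (UnitaryGroup.finAdelicToAdelic F E c M JW u)) :=
  rfl

/-- **An automorphic central twist keeps compatibility**: if `ĉ = 1` on `G₁(F)` then `s ⊗ ĉ` is compatible when
`s` is (vendored `IsCompatible.of_central_twist` with `ν := (1, ĉ·id)`, `π(1, c·id) = 1`).
[cite: GelbartRogawski1991, §3.1 Remark p. 457 L4–13] -/
theorem isCompatible_twist (hs : (splittingDatum F E c N M e JV JW hcδ hδ hd hV hW hVd hWd hJV hJW).IsCompatible s)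
    (hrat : ∀ γ ∈ (splittingDatum F E c N M e JV JW hcδ hδ hd hV hW hVd hWd hJV hJW).ratPts, ĉ γ = 1) :
    (splittingDatum F E c N M e JV JW hcδ hδ hd hV hW hVd hWd hJV hJW).IsCompatible
      (adelicMpCont.twist F (Fin n) (adelicGram F e TV TW) s ĉ) :=
  hs.of_central_twist (fun g => adelicMpCont.ofScalar F (Fin n) (adelicGram F e TV TW) (ĉ g))
    (fun g => by simp only [splittingDatum_proj, adelicMpCont.proj_ofScalar])
    (fun g => adelicMpCont.twist_apply s ĉ g) fun γ hγ => by simp only [hrat γ hγ, map_one]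

omit [Algebra.IsQuadraticExtension F E] in
/-- `(s ⊗ ĉ)_pair (x, y) = (1, ĉ(x ⊗ y)·id) · s_pair (x, y)`. [folklore] -/
theorem pairSplitting_twist_apply (p : UnitaryGroup.adelic F E c N JV × UnitaryGroup.adelic F E c M JW) :
    pairSplitting F E c N M e JV JW (adelicMpCont.twist F (Fin n) (adelicGram F e TV TW) s ĉ) p =
      adelicMpCont.ofScalar F (Fin n) (adelicGram F e TV TW)
          (ĉ (UnitaryGroup.adelicInl F E c N M JV JW p.1 * UnitaryGroup.adelicInr F E c N M JV JW p.2)) *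
        pairSplitting F E c N M e JV JW s p := by
  simp only [pairSplitting_apply, adelicMpCont.twist_apply]

omit [Algebra.IsQuadraticExtension F E] in
/-- **`ω_ψ ∘ (s ⊗ ĉ)_pair = ĉ_pair • ω_ψ ∘ s_pair`.** [cite: GelbartRogawski1991, §3.1 p. 454] -/
theorem pairRep_twist_apply (p : UnitaryGroup.adelic F E c N JV × UnitaryGroup.adelic F E c M JW)
    (Φ : piSchwartzBruhat F (Fin n)) :
    pairRep F E c N M e JV JW (adelicMpCont.twist F (Fin n) (adelicGram F e TV TW) s ĉ) p Φ =
      ((ĉ (UnitaryGroup.adelicInl F E c N M JV JW p.1 * UnitaryGroup.adelicInr F E c N M JV JW p.2) : ℂˣ) : ℂ) •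
        pairRep F E c N M e JV JW s p Φ := by
  simp only [pairRep_apply, pairSplitting_twist_apply, map_mul (adelicMpCont.omega F (Fin n) (adelicGram F e TV TW)),
    Module.End.mul_apply, adelicMpCont.omega_ofScalar]

omit [Algebra.IsQuadraticExtension F E] in
/-- the same in the Kronecker currency of `pairSmall₁`. [folklore] -/
theorem omega_pairSmall₁_twist_apply (p : UnitaryGroup.adelic F E c N JV × UnitaryGroup.adelic F E c M JW)
    (Φ : piSchwartzBruhat F (Fin N × Fin M)) :
    adelicMpCont.omega F (Fin N × Fin M) _
        (pairSmall₁ F E c N M e JV JW (adelicMpCont.twist F (Fin n) (adelicGram F e TV TW) s ĉ) p) Φ =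
      ((ĉ (UnitaryGroup.adelicInl F E c N M JV JW p.1 * UnitaryGroup.adelicInr F E c N M JV JW p.2) : ℂˣ) : ℂ) •
        adelicMpCont.omega F (Fin N × Fin M) _ (pairSmall₁ F E c N M e JV JW s p) Φ := by
  simp only [omega_pairSmall₁_apply, pairRep_twist_apply, LinearEquiv.map_smul]

section FinTwist

open scoped SchwartzMap TensorProduct Classical
open NumberField.mixedEmbedding IsDedekindDomain


-- port_pkg: scope closed for this part
end FinTwist
end Twist
end WeilCoinv
end HodgeCM
end
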